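import Literature.Probability.LatticeModels.RandomClusterConditionalDomination
import Literature.Probability.LatticeModels.RandomClusterRimWiringWired
import Literature.Probability.LatticeModels.RandomClusterRimWiringEvents
import Literature.Probability.Percolation.BlockExplorationBasic
import Literature.Probability.LatticeModels.FKIsingAnnulusCrossingRSW
import HarnessLib

/-!
# Pushing boundary conditions across a collar: exploration and domain Markov tools (proved)

Topic `Literature/Probability/LatticeModels` (trunk `StatMech`, family `crit-ising`). Tools for the
monotone boundary-condition toolkit of Kesten's ratio-limit scheme (H. Kesten, *The incipient infinite
cluster in two-dimensional percolation*, PTRF 73 (1986), Lemma (29) and proof of Lemma (23)) for the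
finite-graph random-cluster measure `φ^B_{G,p,q} = rcMeasure G p q B`, consumed by
`RandomClusterBoundaryPushing.lean` / `RandomClusterBoundaryPushingSep.lean`. The geometry is
abstract and non-planar: a graph `⟨E⟩ = fromEdgeSet ↑E` spanned by a finite edge set `E`, a CORE
vertex set, a disjoint COLLAR `Ann` such that every `E`-edge at a core vertex has both endpoints in
`Core ∪ Ann`; a RADIAL CROSSING is an `⟨E⟩`-walk from `Core` to the outside of `Core ∪ Ann` with
interior in `Ann` and open edges.

* Combinatorics of radial crossings: the event is increasing (`isUpperSet_radialCrossing`) and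
  determined on the genuine collar edges (`mem_and_touch_of_mem_edges_radialCrossing`,
  `inter_mem_radialCrossing`); exploring the collar FROM OUTSIDE (`explSet Rest Ann`,
  `Rest = (Core ∪ Ann)ᶜ`, the device of Basu–Sapozhnikov 2017, §2), a rim vertex yields an open
  radial crossing (`radialCrossing_of_mem_explRim`), so off the crossing event the rim is empty.
* `rcMeasure_real_inter_eq_mul_of_rim_wired_wired` — the far-wired rim Markov property
  (`RandomClusterRimWiringWired.lean`) summed over an outside event, exactly as
  `rcMeasure_real_inter_eq_mul_of_rim_wired` sums the free one;
  `rcMeasure_real_inter_explEvent_empty_eq_mul` — on a datum event `{𝒞 = X, 𝒟 = ∅}` (empty rim)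
  the unexplored configuration is the FREE random-cluster configuration of the edges off `X`.
* Small measure facts: `rcMeasure_congr_graph`, `rcMeasure_ae_eq_of_forall_subset_edgeSet`,
  `rcMeasure_real_le_fromEdgeSet_of_isLowerSet` (complement of `rcMeasure_fromEdgeSet_real_le`),
  `rcMeasure_real_cylinder_empty_pos`.

Everything is proved; no definitions.

## References

* H. Kesten, The incipient infinite cluster in two-dimensional percolation, *Probab. Theory Related
  Fields* 73 (1986) 369–394: Lemma (29), proof of Lemma (23), proof of Thm. 3.
* G. Grimmett, *The Random-Cluster Model*, Springer (2006): Thm. (3.1)(a), Lemma (4.13), Lemma (4.14).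
* D. Basu, A. Sapozhnikov, Kesten's incipient infinite cluster and quasi-multiplicativity of crossing
  probabilities, *Electron. Commun. Probab.* 22 (2017) no. 26, §2.
-/

noncomputable section

open MeasureTheory Finset SimpleGraph
open Literature.Probability.Percolation (BondConfig openConnIn openGraph explSet explRim explEvent)

namespace Literature.Probability.LatticeModels

variable {V : Type*}

/-! ### Radial crossings of the collar and the outside-in exploration -/

section Combinatorics

/-- The radial crossing event is increasing. [folklore] -/
theorem isUpperSet_radialCrossing (E : Finset (Sym2 V)) (Core Ann : Set V) :
    IsUpperSet {ω : BondConfig V | ∃ (a b : V) (w : (fromEdgeSet (E : Set (Sym2 V))).Walk a b),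
      a ∈ Core ∧ b ∉ Core ∪ Ann ∧ (∀ z ∈ w.support, z = a ∨ z = b ∨ z ∈ Ann) ∧
        ∀ e ∈ w.edges, e ∈ ω} :=
  fun _ _ hle ⟨a, b, w, ha, hb, hs, he⟩ ↦ ⟨a, b, w, ha, hb, hs, fun e he' ↦ hle (he e he')⟩

/-- Every edge of a radial crossing walk (from the core to the outside, interior in the collar) is a
genuine edge of `E` touching the collar, provided every `E`-edge at a core vertex has both
endpoints in `Core ∪ Ann` (a one-edge walk `Core → outside` is excluded). [folklore] -/
theorem mem_and_touch_of_mem_edges_radialCrossing {E : Finset (Sym2 V)} {Core Ann : Set V}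
    (hCore : ∀ e ∈ E, (∃ v ∈ Core, v ∈ e) → ∀ x ∈ e, x ∈ Core ∨ x ∈ Ann) {a b : V}
    (w : (fromEdgeSet (E : Set (Sym2 V))).Walk a b) (ha : a ∈ Core) (hb : b ∉ Core ∪ Ann)
    (hs : ∀ z ∈ w.support, z = a ∨ z = b ∨ z ∈ Ann) :
    ∀ e ∈ w.edges, e ∈ E ∧ ¬ e.IsDiag ∧ ∃ z ∈ Ann, z ∈ e := by
  intro e
  induction e using Sym2.ind with
  | h x y =>
    intro he
    have heG := w.edges_subset_edgeSet he
    rw [edgeSet_fromEdgeSet] at heG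
    obtain ⟨heE, hnd⟩ := heG
    have heE : s(x, y) ∈ E := Finset.mem_coe.1 heE
    have hne : x ≠ y := fun h ↦ hnd (Sym2.mk_isDiag_iff.2 h)
    refine ⟨heE, hnd, ?_⟩
    have hx := w.fst_mem_support_of_mem_edges he
    have hy := w.snd_mem_support_of_mem_edges he
    rcases hs x hx with hxa | hxb | hxA
    · rcases hs y hy with hya | hyb | hyA
      · exact absurd (hxa.trans hya.symm) hne
      · have h := hCore _ heE ⟨x, hxa ▸ ha, Sym2.mem_mk_left x y⟩ y (Sym2.mem_mk_right x y)
        exact absurd (hyb ▸ h) hb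
      · exact ⟨y, hyA, Sym2.mem_mk_right x y⟩
    · rcases hs y hy with hya | hyb | hyA
      · have h := hCore _ heE ⟨y, hya ▸ ha, Sym2.mem_mk_right x y⟩ x (Sym2.mem_mk_left x y)
        exact absurd (hxb ▸ h) hb
      · exact absurd (hxb.trans hyb.symm) hne
      · exact ⟨y, hyA, Sym2.mem_mk_right x y⟩
    · exact ⟨x, hxA, Sym2.mem_mk_left x y⟩

/-- A radial crossing survives the restriction of the configuration to any edge set containing the
genuine `E`-edges touching the collar: the crossing event is determined on the collar edges.
[folklore] -/
theorem inter_mem_radialCrossing {E : Finset (Sym2 V)} {Core Ann : Set V}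
    (hCore : ∀ e ∈ E, (∃ v ∈ Core, v ∈ e) → ∀ x ∈ e, x ∈ Core ∨ x ∈ Ann) {T : Set (Sym2 V)}
    (hT : ∀ e ∈ E, ¬ e.IsDiag → (∃ z ∈ Ann, z ∈ e) → e ∈ T) {ω : BondConfig V}
    (hω : ω ∈ {ω : BondConfig V | ∃ (a b : V) (w : (fromEdgeSet (E : Set (Sym2 V))).Walk a b),
      a ∈ Core ∧ b ∉ Core ∪ Ann ∧ (∀ z ∈ w.support, z = a ∨ z = b ∨ z ∈ Ann) ∧
        ∀ e ∈ w.edges, e ∈ ω}) :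
    ω ∩ T ∈ {ω : BondConfig V | ∃ (a b : V) (w : (fromEdgeSet (E : Set (Sym2 V))).Walk a b),
      a ∈ Core ∧ b ∉ Core ∪ Ann ∧ (∀ z ∈ w.support, z = a ∨ z = b ∨ z ∈ Ann) ∧
        ∀ e ∈ w.edges, e ∈ ω} := by
  obtain ⟨a, b, w, ha, hb, hs, he⟩ := hω
  refine ⟨a, b, w, ha, hb, hs, fun e he' ↦ ⟨he e he', ?_⟩⟩
  obtain ⟨h1, h2, h3⟩ := mem_and_touch_of_mem_edges_radialCrossing hCore w ha hb hs e he'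
  exact hT e h1 h2 h3

/-- **A rim vertex of the outside-in exploration of the collar yields an open radial crossing**
(the exploration device of Basu–Sapozhnikov 2017, §2, run from the OUTSIDE `Rest = (Core ∪ Ann)ᶜ`
into the collar, in Kesten's shielding argument, 1986, proof of Lemma (23)): if a vertex `r` outside
the explored set carries an open `E`-edge into it, then `r ∈ Core`, its neighbour lies in `Ann` and
is joined to `Rest` inside `Rest ∪ Ann` by an open path, whose piece up to the first vertex of
`Rest` gives, read from `r`, an open walk `Core → Rest` with interior in `Ann`.
[cite: Kesten1986, Lemma (29) and proof of Lemma (23)] -/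
theorem radialCrossing_of_mem_explRim {E : Finset (Sym2 V)} {Core Ann Rest : Set V}
    (hCA : ∀ v ∈ Core, v ∉ Ann)
    (hCore : ∀ e ∈ E, (∃ v ∈ Core, v ∈ e) → ∀ x ∈ e, x ∈ Core ∨ x ∈ Ann)
    (hRest : ∀ v, v ∈ Rest ↔ v ∉ Core ∧ v ∉ Ann) {ω : BondConfig V}
    (hω : ω ⊆ (fromEdgeSet (E : Set (Sym2 V))).edgeSet) {r : V} (hr : r ∈ explRim Rest Ann ω) :
    ω ∈ {ω : BondConfig V | ∃ (a b : V) (w : (fromEdgeSet (E : Set (Sym2 V))).Walk a b),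
      a ∈ Core ∧ b ∉ Core ∪ Ann ∧ (∀ z ∈ w.support, z = a ∨ z = b ∨ z ∈ Ann) ∧
        ∀ e ∈ w.edges, e ∈ ω} := by
  obtain ⟨-, v, hv, hvr⟩ := Percolation.mem_explRim_iff.1 hr
  have hrRA : r ∉ Rest ∪ Ann := Percolation.explRim_disjoint hr
  have hrC : r ∈ Core := by
    by_contra h
    exact hrRA (Or.inl ((hRest r).2 ⟨h, fun h' ↦ hrRA (Or.inr h')⟩))
  have hvrG : (fromEdgeSet (E : Set (Sym2 V))).Adj v r := hω hvr
  have hvrE : s(v, r) ∈ E := Finset.mem_coe.1 ((fromEdgeSet_adj _).1 hvrG).1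
  have hvA : v ∈ Ann := by
    rcases hCore _ hvrE ⟨r, hrC, Sym2.mem_mk_right v r⟩ v (Sym2.mem_mk_left v r) with hvC | hvA
    · exfalso
      rcases Percolation.explSet_subset Rest Ann ω hv with hvR | hvA
      · exact ((hRest v).1 hvR).1 hvC
      · exact hCA v hvC hvA
    · exact hvA
  have hvR : v ∉ Rest := fun h ↦ ((hRest v).1 h).2 hvA
  obtain ⟨-, u, hu, huv⟩ := (Percolation.mem_explSet_iff.1 hv).resolve_left hvR
  have hvu := Percolation.openConnIn_reverse huv
  rw [Percolation.mem_openConnIn_iff_pathIn] at hvu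
  have huA : u ∉ Ann := fun h ↦ ((hRest u).1 hu).2 h
  obtain ⟨x, y, -, hyA, hyRA, hxy, hvx⟩ := hvu.exit (R := Ann) hvA huA
  have hyR : y ∈ Rest := hyRA.resolve_right hyA
  have hvx' : ω ∈ openConnIn Ann v x := by
    rw [Percolation.mem_openConnIn_iff_pathIn]
    exact hvx.mono Set.inter_subset_left
  obtain ⟨p, hpS, hpE⟩ :=
    Percolation.exists_walk_of_mem_openConnIn (G := fromEdgeSet (E : Set (Sym2 V))) hω hvx'
  rw [Percolation.openGraph_adj] at hxy
  have hxyG : (fromEdgeSet (E : Set (Sym2 V))).Adj x y := hω hxy.1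
  refine ⟨r, y, Walk.cons hvrG.symm (p.concat hxyG), hrC, ?_, ?_, ?_⟩
  · rintro (hyC | hyA')
    · exact ((hRest y).1 hyR).1 hyC
    · exact ((hRest y).1 hyR).2 hyA'
  · intro z hz
    rw [Walk.support_cons, List.mem_cons, Walk.support_concat, List.mem_append,
      List.mem_singleton] at hz
    rcases hz with rfl | hz | rfl
    · exact Or.inl rfl
    · exact Or.inr (Or.inr (hpS z hz))
    · exact Or.inr (Or.inl rfl)
  · intro e he
    rw [Walk.edges_cons, List.mem_cons, Walk.edges_concat, List.concat_eq_append, List.mem_append,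
      List.mem_singleton] at he
    rcases he with rfl | he | rfl
    · rw [Sym2.eq_swap]; exact hvr
    · exact hpE e he
    · exact hxy.1

/-- In the collar setting, an event determined by the `E`-edges inside `Core` is unchanged, on
lattice configurations `ω ⊆ E(⟨E⟩)`, by restriction to a region containing every genuine edge with
both endpoints off a set `X` disjoint from `Core`. [folklore] -/
theorem inter_mem_iff_of_determined_core {E : Finset (Sym2 V)} {Core X : Set V}
    (hCX : ∀ v ∈ Core, v ∉ X) {U : Finset (Sym2 V)}
    (hU : ∀ e, e ∈ U ↔ e ∈ (fromEdgeSet (E : Set (Sym2 V))).edgeSet ∧ ∀ x ∈ e, x ∉ X)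
    {A : Set (BondConfig V)}
    (hA : ∀ ω₁ ω₂ : BondConfig V, (∀ e ∈ E, (∀ x ∈ e, x ∈ Core) → (e ∈ ω₁ ↔ e ∈ ω₂)) →
      (ω₁ ∈ A ↔ ω₂ ∈ A))
    {ω : BondConfig V} (hω : ω ⊆ (fromEdgeSet (E : Set (Sym2 V))).edgeSet) :
    ω ∩ (↑U : Set (Sym2 V)) ∈ A ↔ ω ∈ A := by
  refine hA _ _ fun e _ heC ↦ ⟨fun h ↦ h.1, fun h ↦ ⟨h, Finset.mem_coe.2 ((hU e).2 ⟨hω h, ?_⟩)⟩⟩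
  exact fun x hx hxX ↦ hCX x (heC x hx) hxX

/-- The edge set of the graph `⟨E⟩` spanned by a finite edge set `E` consists of the non-diagonal
elements of `E` (for every `Fintype` instance). [folklore] -/
theorem mem_edgeFinset_fromEdgeSet_iff (E : Finset (Sym2 V))
    (i : Fintype (fromEdgeSet (E : Set (Sym2 V))).edgeSet) (e : Sym2 V) :
    e ∈ @edgeFinset V (fromEdgeSet (E : Set (Sym2 V))) i ↔ e ∈ E ∧ ¬ e.IsDiag := by
  rw [@mem_edgeFinset V _ e i, edgeSet_fromEdgeSet, Set.mem_sdiff, Finset.mem_coe, Sym2.mem_diagSet]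

/-- **The unexplored region of a datum of the outside-in exploration.** If `X` is the explored set
of some configuration (so `Rest ⊆ X ⊆ Rest ∪ Ann` misses the core), the genuine `E`-edges with both
endpoints off `X` form a region `U ⊆ E(⟨E⟩)` on which every event determined by the `E`-edges
inside the core lives, as far as lattice configurations are concerned. [folklore] -/
theorem exists_region_off_explSet {E : Finset (Sym2 V)} {Core Ann Rest : Set V}
    (hCA : ∀ v ∈ Core, v ∉ Ann) (hRest : ∀ v, v ∈ Rest ↔ v ∉ Core ∧ v ∉ Ann) {X : Set V}
    {ω₀ : BondConfig V} (hω₀ : explSet Rest Ann ω₀ = X) {A : Set (BondConfig V)}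
    (hA : ∀ ω₁ ω₂ : BondConfig V, (∀ e ∈ E, (∀ x ∈ e, x ∈ Core) → (e ∈ ω₁ ↔ e ∈ ω₂)) →
      (ω₁ ∈ A ↔ ω₂ ∈ A)) :
    ∃ U : Finset (Sym2 V),
      (∀ e, e ∈ U ↔ e ∈ (fromEdgeSet (E : Set (Sym2 V))).edgeSet ∧ ∀ x ∈ e, x ∉ X) ∧
      (∀ i : Fintype (fromEdgeSet (E : Set (Sym2 V))).edgeSet,
        U ⊆ @edgeFinset V (fromEdgeSet (E : Set (Sym2 V))) i) ∧
      ∀ ω : BondConfig V, ω ⊆ (fromEdgeSet (E : Set (Sym2 V))).edgeSet →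
        (ω ∩ (↑U : Set (Sym2 V)) ∈ A ↔ ω ∈ A) := by
  classical
  have hXsub : X ⊆ Rest ∪ Ann := hω₀ ▸ Percolation.explSet_subset Rest Ann ω₀
  have hCX : ∀ v ∈ Core, v ∉ X := fun v hv hvX ↦
    (hXsub hvX).elim (fun h ↦ ((hRest v).1 h).1 hv) (fun h ↦ hCA v hv h)
  refine ⟨E.filter (fun e ↦ ¬ e.IsDiag ∧ ∀ x ∈ e, x ∉ X), fun e ↦ ?_, fun i e he ↦ ?_, ?_⟩
  · rw [Finset.mem_filter, edgeSet_fromEdgeSet, Set.mem_sdiff, Finset.mem_coe, Sym2.mem_diagSet,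
      and_assoc]
  · exact (mem_edgeFinset_fromEdgeSet_iff E i e).2
      ⟨(Finset.mem_filter.1 he).1, (Finset.mem_filter.1 he).2.1⟩
  · intro ω hω
    refine inter_mem_iff_of_determined_core hCX (fun e ↦ ?_) hA hω
    rw [Finset.mem_filter, edgeSet_fromEdgeSet, Set.mem_sdiff, Finset.mem_coe, Sym2.mem_diagSet,
      and_assoc]

end Combinatorics

/-! ### Domain Markov tools -/

section Finite

variable [Fintype V] [DecidableEq V]

/-- The random-cluster measure does not depend on the decidability instance of the adjacency
relation, so equal graphs have equal measures. [folklore] -/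
theorem rcMeasure_congr_graph {G G' : SimpleGraph V} [DecidableRel G.Adj] [DecidableRel G'.Adj]
    (h : G = G') (p q : ℝ) (B : Set V) : rcMeasure G p q B = rcMeasure G' p q B := by
  subst h
  congr

variable (G : SimpleGraph V) [DecidableRel G.Adj]

/-- Events that agree on the lattice configurations `ω ⊆ E(G)` are almost surely equal (the
random-cluster measure is carried by the edge sets of `G`); with `measureReal_congr` they have the
same probability. [cite: Grimmett2006, §1.2, eq. (1.2)] -/
theorem rcMeasure_ae_eq_of_forall_subset_edgeSet {p q : ℝ} (hp : p ∈ Set.Icc (0 : ℝ) 1)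
    (hq : 0 < q) (B : Set V) {A A' : Set (BondConfig V)}
    (h : ∀ ω : BondConfig V, ω ⊆ G.edgeSet → (ω ∈ A ↔ ω ∈ A')) :
    A =ᵐ[rcMeasure G p q B] A' := by
  haveI := isProbabilityMeasure_rcMeasure G hp hq B
  have h0 : ∀ {S : Set (BondConfig V)}, (∀ ω : BondConfig V, ω ⊆ G.edgeSet → ω ∉ S) →
      rcMeasure G p q B S = 0 := by
    intro S hS
    rw [← measureReal_eq_zero_iff (measure_ne_top _ _)]
    refine le_antisymm ?_ measureReal_nonneg
    rw [← measureReal_empty (μ := rcMeasure G p q B)]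
    exact rcMeasure_real_mono_of_forall_subset_edgeSet G hp hq B fun ω hω hS' ↦ (hS ω hω hS').elim
  exact ae_eq_set.2
    ⟨h0 fun ω hω hm ↦ hm.2 ((h ω hω).1 hm.1), h0 fun ω hω hm ↦ hm.2 ((h ω hω).2 hm.1)⟩

/-- **Domain Markov with the rim wired from outside, far wired set `B`, summed over an outside
event** (the far-wired companion of `rcMeasure_real_inter_eq_mul_of_rim_wired`; Kesten 1986, proof
of Thm. 3, second and later circuits; Grimmett 2006, Lemma (4.13)). Let `U ⊆ E(G)` be a region whose
edges have both endpoints in `X`, `B ∩ X = ∅`, `F` an event determined by the configuration off `U`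
such that every configuration `ζ ⊆ E(G) ∖ U` with `↑ζ ∈ F` touches `X` only at rim vertices and joins
any two vertices of the rim `W` in `⟨ζ⟩ ∨ K_B`. Then for every event `A`,
`φ^B_G({ω ∩ U ∈ A} ∩ F) = φ^B_G(F) · φ^W_{⟨U⟩}(A)` (`0 ≤ p ≤ 1`, `q > 0`).
[cite: Kesten1986, proof of Thm. 3] -/
theorem rcMeasure_real_inter_eq_mul_of_rim_wired_wired {p q : ℝ}
    (hp : p ∈ Set.Icc (0 : ℝ) 1) (hq : 0 < q) {B W X : Set V} (U : Finset (Sym2 V))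
    (hU : U ⊆ G.edgeFinset) (hUX : ∀ e ∈ U, ∀ x ∈ e, x ∈ X) (hBX : ∀ b ∈ B, b ∉ X)
    (F : Set (Percolation.BondConfig V))
    (hF : ∀ ω₁ ω₂ : Percolation.BondConfig V, ω₁ ∩ (↑U)ᶜ = ω₂ ∩ (↑U)ᶜ → (ω₁ ∈ F ↔ ω₂ ∈ F))
    (hFX : ∀ ζ : Finset (Sym2 V), ζ ⊆ G.edgeFinset \ U → (↑ζ : Percolation.BondConfig V) ∈ F →
      ∀ e ∈ ζ, ∀ x ∈ e, x ∈ X → x ∈ W)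
    (hFW : ∀ ζ : Finset (Sym2 V), ζ ⊆ G.edgeFinset \ U → (↑ζ : Percolation.BondConfig V) ∈ F →
      ∀ x ∈ W, ∀ y ∈ W, (fromEdgeSet (ζ : Set (Sym2 V)) ⊔ wired B).Reachable x y)
    (A : Set (Percolation.BondConfig V)) :
    (rcMeasure G p q B).real ({ω | ω ∩ ↑U ∈ A} ∩ F) =
      (rcMeasure G p q B).real F * (rcMeasure (fromEdgeSet (U : Set (Sym2 V))) p q W).real A := by
  classical
  have hF' : (rcMeasure G p q B).real F = (rcMeasure G p q B).real (Set.univ ∩ F) := by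
    rw [Set.univ_inter]
  rw [rcMeasure_real_inter_eq_sum_cylinder G hp hq B U {ω | ω ∩ ↑U ∈ A} F hF, hF',
    rcMeasure_real_inter_eq_sum_cylinder G hp hq B U Set.univ F hF, Finset.sum_mul]
  refine Finset.sum_congr rfl fun ζ hζ ↦ ?_
  rw [Finset.mem_filter, Finset.mem_powerset] at hζ
  rw [Set.univ_inter]
  exact rcMeasure_real_inter_cylinder_eq_mul_fromEdgeSet_rim_wired G hp hq U hU hζ.1 hUX
    (hFX ζ hζ.1 hζ.2) hBX (hFW ζ hζ.1 hζ.2) A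

/-- **Domain Markov at the explored set of an outside-in exploration with EMPTY rim** (Kesten 1986,
proof of Lemma (23); Basu–Sapozhnikov 2017, §2): explore the block `Blk` from `In`; on the datum
event `{𝒞 = X, 𝒟 = ∅}` no open edge leaves `X`, so for the region `U` of the edges of `G` with both
endpoints off `X` and a wired set `W ⊆ In` of the ambient measure,
`φ^W_G({ω ∩ U ∈ A} ∩ {𝒞 = X, 𝒟 = ∅}) = φ^W_G({𝒞 = X, 𝒟 = ∅}) · φ^∅_{⟨U⟩}(A)` for every event `A`:
conditionally on the exploration, the unexplored configuration is FREE.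
[cite: Kesten1986, Lemma (29) and proof of Lemma (23)] -/
theorem rcMeasure_real_inter_explEvent_empty_eq_mul {p q : ℝ} (hp : p ∈ Set.Icc (0 : ℝ) 1)
    (hq : 0 < q) {W In Blk : Set V} (hW : W ⊆ In) (X : Set V) (U : Finset (Sym2 V))
    (hU : ∀ e, e ∈ U ↔ e ∈ G.edgeSet ∧ ∀ x ∈ e, x ∉ X) (A : Set (BondConfig V)) :
    (rcMeasure G p q W).real ({ω | ω ∩ ↑U ∈ A} ∩ explEvent In Blk X ∅) =
      (rcMeasure G p q W).real (explEvent In Blk X ∅) *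
        (rcMeasure (fromEdgeSet (U : Set (Sym2 V))) p q ∅).real A := by
  by_cases hX : In ⊆ X
  · refine rcMeasure_real_inter_eq_mul_of_rim_wired_wired G hp hq (B := W) (W := ∅) (X := Xᶜ) U
      (fun e he ↦ mem_edgeFinset.2 ((hU e).1 he).1) (fun e he x hx ↦ ((hU e).1 he).2 x hx)
      (fun b hb h ↦ h (hX (hW hb))) _ (fun ω₁ ω₂ h ↦ ?_) ?_ ?_ A
    · refine Percolation.mem_explEvent_iff_of_agree_on_touching fun e ⟨v, hv, hve⟩ ↦ ?_
      have heU : e ∈ (↑U : Set (Sym2 V))ᶜ := fun heU ↦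
        ((hU e).1 (Finset.mem_coe.1 heU)).2 v hve hv
      constructor
      · intro h1
        have h' : e ∈ ω₁ ∩ (↑U : Set (Sym2 V))ᶜ := ⟨h1, heU⟩
        rw [h] at h'
        exact h'.1
      · intro h2
        have h' : e ∈ ω₂ ∩ (↑U : Set (Sym2 V))ᶜ := ⟨h2, heU⟩
        rw [← h] at h'
        exact h'.1
    · intro ζ hζ hζF e he x hx hxX
      have heE := Finset.mem_sdiff.1 (hζ he)
      have hex : ∃ y ∈ e, y ∈ X := by
        by_contra hne
        push Not at hne
        exact heE.2 ((hU e).2 ⟨mem_edgeFinset.1 heE.1, hne⟩)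
      obtain ⟨y, hye, hyX⟩ := hex
      have hxy : x ≠ y := fun h ↦ hxX (h ▸ hyX)
      have he_eq : e = s(x, y) := (Sym2.mem_and_mem_iff hxy).1 ⟨hx, hye⟩
      have hyx : s(y, x) ∈ (↑ζ : BondConfig V) := by
        rw [Sym2.eq_swap, ← he_eq]
        exact Finset.mem_coe.2 he
      exact Percolation.mem_of_mem_explEvent_of_open_edge hζF hyX hyx hxX
    · exact fun _ _ _ x hx ↦ (Set.notMem_empty x hx).elim
  · have h0 : explEvent In Blk X ∅ = ∅ := Set.eq_empty_of_forall_notMem fun ω hω ↦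
      hX (hω.1 ▸ Percolation.subset_explSet In Blk ω)
    rw [h0, Set.inter_empty, measureReal_empty, zero_mul]

/-- **The region (outside closed) versus the ambient measure, decreasing events**: for
`U ⊆ E(G)`, `q ≥ 1` and decreasing `D`, `φ^B_G({ω ∩ U ∈ D}) ≤ φ^B_{⟨U⟩}(D)` (complement of
`rcMeasure_fromEdgeSet_real_le`), provided "all edges off `U` closed" is not null.
[cite: Grimmett2006, Thm. (3.1)(a) and Lemma (4.14)] -/
theorem rcMeasure_real_le_fromEdgeSet_of_isLowerSet {p q : ℝ} (hp : p ∈ Set.Icc (0 : ℝ) 1)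
    (hq : 1 ≤ q) (B : Set V) (U : Finset (Sym2 V)) (hU : U ⊆ G.edgeFinset)
    (h0 : 0 < (rcMeasure G p q B).real {ω | ω ∩ (↑U : Set (Sym2 V))ᶜ = ∅})
    {D : Set (Percolation.BondConfig V)} (hD : IsLowerSet D) :
    (rcMeasure G p q B).real {ω | ω ∩ ↑U ∈ D} ≤
      (rcMeasure (fromEdgeSet (U : Set (Sym2 V))) p q B).real D := by
  have hq0 : 0 < q := one_pos.trans_le hq
  haveI := isProbabilityMeasure_rcMeasure G hp hq0 B
  haveI := isProbabilityMeasure_rcMeasure (fromEdgeSet (U : Set (Sym2 V))) hp hq0 B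
  have h := rcMeasure_fromEdgeSet_real_le G hp hq B U hU h0 hD.compl
  have hc : {ω : BondConfig V | ω ∩ ↑U ∈ Dᶜ} = {ω | ω ∩ ↑U ∈ D}ᶜ := rfl
  rw [hc, probReal_compl_eq_one_sub MeasurableSet.of_discrete,
    probReal_compl_eq_one_sub MeasurableSet.of_discrete] at h
  linarith

/-- The cylinder "all edges off `U` are closed" contains the empty configuration, hence has
positive probability when `p < 1`. [cite: Grimmett2006, §1.2 eq. (1.2)] -/
theorem rcMeasure_real_cylinder_empty_pos {p q : ℝ} (hp : p ∈ Set.Icc (0 : ℝ) 1) (hp1 : p < 1)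
    (hq : 0 < q) (B : Set V) (U : Finset (Sym2 V)) :
    0 < (rcMeasure G p q B).real {ω | ω ∩ (↑U : Set (Sym2 V))ᶜ = ∅} :=
  rcMeasure_real_pos_of_empty_mem G hp hp1 hq B (by simp)

end Finite

end Literature.Probability.LatticeModels

end
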